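import Summits.CriticalPhenomena.PercolationContinuityZ3.Theorems.PercNearOneGluingNoHeavyLowerTailSahiCTCLadderRowTwoTFacts
import HarnessLib

/-!
# `NoHeavyLowerTail` (crux stmt-CriticalPhenomena-4575), P3 lane: the row `#dbl = 2` of `(L_t)`, all `t` — the five supply facts

Support file (seat `prim-l12-p3`, gen 26; `--supports stmt-CriticalPhenomena-4575`).  Memo g26 §4.16.  With `#(lev m 1) + 2 = n + t`
(`n ≥ 2t − 2`) and `dbl m = {d, d'}`, the normalised lower bounds for the three cube families of the row: plain `t`-DENSITY and PINNED
`t`-density at `d` on the restriction cubes (`rowTwoT_supply_R`), plain and pinned `(t−1)`-density on the link cubes of base `d'`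
(`rowTwoT_supply_M`), `(t−2)`-density on the double-link cubes (`rowTwoT_supply_L`), in exactly the integer forms consumed by
`rowTwoT_arith`.  Nothing is asserted about the crux.
-/

namespace Summit.CriticalPhenomena.PercolationContinuityZ3.Theorems.SahiCTCForms

open Finset MvPolynomial SahiCTCGenFun SahiCTCWeightedLYM

variable {α : Type*} [DecidableEq α] [Fintype α]

section RowTwoTSupply
variable {𝒳 𝒵 : Finset (Finset α)}

omit [Fintype α] in
/-- Pinned common `(t−1)`-sets of the link cube `({d'}, d ∪ s)`: the `a`-sets `D ∪ Y`, `Y ⊆ s`. [this work] -/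
theorem card_filter_le_pinned_linkT {t : ℕ} (ht : 2 ≤ t) {T s D : Finset α} {d d' : α} (hDe : D = {d, d'}) (hdT : d ∉ T) :
    #((((T.powersetCard (t - 2)).filter fun Y => D ∪ Y ∈ 𝒳 ∧ D ∪ Y ∈ 𝒵)).filter fun w => w ⊆ s)
      ≤ #((csetsT 𝒳 𝒵 {d'} (insert d s) (t - 1)).filter fun w => d ∈ w) := by
  refine card_le_card_of_injOn (fun Y => insert d Y) (fun Y hY => ?_) (fun Y hY Y' hY' h => ?_)
  · obtain ⟨hYA, hYs⟩ := mem_filter.1 (Finset.mem_coe.1 hY)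
    obtain ⟨hY1, hX, hZ⟩ := mem_filter.1 hYA
    obtain ⟨hYT, hYc⟩ := mem_powersetCard.1 hY1
    have e : {d'} ∪ insert d Y = D ∪ Y := by
      rw [hDe]; ext x; simp only [mem_union, mem_insert, mem_singleton]; tauto
    refine Finset.mem_coe.2 (mem_filter.2 ⟨mem_csetsT.2 ⟨insert_subset_insert d hYs, ?_, ?_, ?_⟩, mem_insert_self d Y⟩)
    · rw [card_insert_of_notMem (fun h => hdT (hYT h)), hYc]; omega
    · rw [e]; exact hX
    · rw [e]; exact hZ
  · have hYT := (mem_powersetCard.1 (mem_filter.1 (mem_filter.1 (Finset.mem_coe.1 hY)).1).1).1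
    have hYT' := (mem_powersetCard.1 (mem_filter.1 (mem_filter.1 (Finset.mem_coe.1 hY')).1).1).1
    have h' : insert d Y = insert d Y' := h
    rw [← erase_insert (fun h => hdT (hYT h)), h', erase_insert (fun h => hdT (hYT' h))]

omit [Fintype α] in
/-- Unpinned common `(t−1)`-sets of the link cube `({d'}, d ∪ s)`: the `d'`-sets `d' ∪ Q`, `Q ⊆ s`. [this work] -/
theorem card_filter_le_unpinned_linkT {t : ℕ} {T s : Finset α} {d d' : α} (hdT : d ∉ T) :
    #((((T.powersetCard (t - 1)).filter fun Q => insert d' Q ∈ 𝒳 ∧ insert d' Q ∈ 𝒵)).filter fun w => w ⊆ s)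
      ≤ #((csetsT 𝒳 𝒵 {d'} (insert d s) (t - 1)).filter fun w => d ∉ w) := by
  refine card_le_card fun Q hQ => ?_
  obtain ⟨hQG, hQs⟩ := mem_filter.1 hQ
  obtain ⟨hQ2, hX, hZ⟩ := mem_filter.1 hQG
  obtain ⟨hQT, hQc⟩ := mem_powersetCard.1 hQ2
  refine mem_filter.2 ⟨mem_csetsT.2 ⟨hQs.trans (subset_insert d s), hQc, ?_, ?_⟩, fun h => hdT (hQT h)⟩
  · rw [← insert_eq]; exact hX
  · rw [← insert_eq]; exact hZ

omit [Fintype α] in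
/-- **Supply facts of the restriction cubes of the row `#dbl = 2` of `(L_t)`** (plain and pinned at `d`; `#(lev m 1) + 2 = n + t`,
`n ≥ 2t − 2`). [this work] -/
theorem rowTwoT_supply_R (h𝒳 : IsUpperSet (𝒳 : Set (Finset α))) (h𝒵 : IsUpperSet (𝒵 : Set (Finset α)))
    {t : ℕ} (ht : 2 ≤ t) (hXt : ∀ S ∈ 𝒳, t ≤ #S) (hZt : ∀ S ∈ 𝒵, t ≤ #S) {m : α →₀ ℕ} {d d' : α} (hDe : dbl m = {d, d'}) (hdd' : d ≠ d')
    {n : ℕ} (hn : #(lev m 1) + 2 = n + t) (hnt : 2 * t ≤ n + 2) :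
    ((cH t (n + 2) : ℤ) * (t * (t - 1) * (n * (n - 1) * #(((lev m 1).powersetCard (t - 2)).filter fun Y => dbl m ∪ Y ∈ 𝒳 ∧ dbl m ∪ Y ∈ 𝒵)
        + (n - 1) * (n - t + 2) * (#(((lev m 1).powersetCard (t - 1)).filter fun Q => insert d Q ∈ 𝒳 ∧ insert d Q ∈ 𝒵)
          + #(((lev m 1).powersetCard (t - 1)).filter fun Q => insert d' Q ∈ 𝒳 ∧ insert d' Q ∈ 𝒵))
        + (n - t + 2) * (n - t + 1) * #(((lev m 1).powersetCard t).filter fun E => E ∈ 𝒳 ∧ E ∈ 𝒵)))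
      ≤ ((n : ℤ) + 2) * (n + 1) * n * (n - 1) * ∑ Y ∈ (lev m 1).powersetCard (t - 2), kap 𝒳 𝒵 ∅ (dbl m ∪ (lev m 1 \ Y))) ∧
    ((cH t (n + 1) : ℤ) * ((t - 1) * n * (n - 1) * #(((lev m 1).powersetCard (t - 2)).filter fun Y => dbl m ∪ Y ∈ 𝒳 ∧ dbl m ∪ Y ∈ 𝒵)
        + (t - 1) * (n - 1) * (n - t + 2) * #(((lev m 1).powersetCard (t - 1)).filter fun Q => insert d Q ∈ 𝒳 ∧ insert d Q ∈ 𝒵))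
      + (cH (t - 1) (n + 1) : ℤ) * (t * (t - 1) * (n - 1) * #(((lev m 1).powersetCard (t - 1)).filter fun Q => insert d' Q ∈ 𝒳 ∧ insert d' Q ∈ 𝒵)
        + t * (t - 1) * (n - t + 1) * #(((lev m 1).powersetCard t).filter fun E => E ∈ 𝒳 ∧ E ∈ 𝒵))
      ≤ ((n : ℤ) + 1) * n * (n - 1) * ∑ Y ∈ (lev m 1).powersetCard (t - 2), kap 𝒳 𝒵 ∅ (dbl m ∪ (lev m 1 \ Y))) := by
  have hDT : Disjoint (dbl m) (lev m 1) := disjoint_dbl_lev_one m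
  have hd : d ∈ dbl m := by rw [hDe]; simp
  have hd' : d' ∈ dbl m := by rw [hDe]; simp
  have hdT : d ∉ lev m 1 := fun h => disjoint_left.1 hDT hd h
  have hd'T : d' ∉ lev m 1 := fun h => disjoint_left.1 hDT hd' h
  set A1 := ((lev m 1).powersetCard (t - 2)).filter fun Y => dbl m ∪ Y ∈ 𝒳 ∧ dbl m ∪ Y ∈ 𝒵 with hA1
  set Qd := ((lev m 1).powersetCard (t - 1)).filter fun Q => insert d Q ∈ 𝒳 ∧ insert d Q ∈ 𝒵 with hQd
  set Qd' := ((lev m 1).powersetCard (t - 1)).filter fun Q => insert d' Q ∈ 𝒳 ∧ insert d' Q ∈ 𝒵 with hQd'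
  set ET := ((lev m 1).powersetCard t).filter fun E => E ∈ 𝒳 ∧ E ∈ 𝒵 with hET
  have htn : t ≤ n := by omega
  have h2n : 2 ≤ n := by omega
  have hltX : ∀ s, ∀ U ∈ tr 𝒳 ∅ s, t ≤ #U := fun s U hU => hXt U (by simpa using (mem_tr.1 hU).2)
  have hltZ : ∀ s, ∀ U ∈ tr 𝒵 ∅ s, t ≤ #U := fun s U hU => hZt U (by simpa using (mem_tr.1 hU).2)
  have hnY : ∀ Y ∈ (lev m 1).powersetCard (t - 2), #(dbl m ∪ (lev m 1 \ Y)) = n + 1 + 1 := fun Y hY => by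
    rw [card_union_of_disjoint (hDT.mono_right sdiff_subset), hDe, card_pair hdd', card_sdiff_of_subset (mem_powersetCard.1 hY).1,
      (mem_powersetCard.1 hY).2]; omega
  have hA1' : ∀ w ∈ A1, w ⊆ lev m 1 ∧ #w = t - 2 := fun w hw => mem_powersetCard.1 (mem_filter.1 hw).1
  have hQd'' : ∀ w ∈ Qd, w ⊆ lev m 1 ∧ #w = t - 1 := fun w hw => mem_powersetCard.1 (mem_filter.1 hw).1
  have hQd''' : ∀ w ∈ Qd', w ⊆ lev m 1 ∧ #w = t - 1 := fun w hw => mem_powersetCard.1 (mem_filter.1 hw).1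
  have hET' : ∀ w ∈ ET, w ⊆ lev m 1 ∧ #w = t := fun w hw => mem_powersetCard.1 (mem_filter.1 hw).1
  -- double counting over the restriction cubes Y
  have dA : ∑ Y ∈ (lev m 1).powersetCard (t - 2), (#(A1.filter fun w => w ⊆ lev m 1 \ Y) : ℤ) = #A1 * (n.choose (t - 2) : ℕ) := by
    have := sum_card_filter_subset_sdiff hA1' (t - 2); rw [show #(lev m 1) - (t - 2) = n from by omega] at this; exact_mod_cast this
  have dQ : ∑ Y ∈ (lev m 1).powersetCard (t - 2), (#(Qd.filter fun w => w ⊆ lev m 1 \ Y) : ℤ) = #Qd * ((n - 1).choose (t - 2) : ℕ) := by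
    have := sum_card_filter_subset_sdiff hQd'' (t - 2); rw [show #(lev m 1) - (t - 1) = n - 1 from by omega] at this; exact_mod_cast this
  have dQ' : ∑ Y ∈ (lev m 1).powersetCard (t - 2), (#(Qd'.filter fun w => w ⊆ lev m 1 \ Y) : ℤ) = #Qd' * ((n - 1).choose (t - 2) : ℕ) := by
    have := sum_card_filter_subset_sdiff hQd''' (t - 2); rw [show #(lev m 1) - (t - 1) = n - 1 from by omega] at this; exact_mod_cast this
  have dE : ∑ Y ∈ (lev m 1).powersetCard (t - 2), (#(ET.filter fun w => w ⊆ lev m 1 \ Y) : ℤ) = #ET * ((n - 2).choose (t - 2) : ℕ) := by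
    have := sum_card_filter_subset_sdiff hET' (t - 2); rw [show #(lev m 1) - t = n - 2 from by omega] at this; exact_mod_cast this
  -- binomial identities
  obtain ⟨t2, ht2⟩ : ∃ t2, t = t2 + 2 := ⟨t - 2, by omega⟩
  have htm2 : t - 2 = t2 := by omega
  have htm1 : t - 1 = t2 + 1 := by omega
  -- i1: (n+2)(n+1) C(n,t-2) = t(t-1) C(n+2,t)
  have i1 : (n + 2) * (n + 1) * n.choose (t - 2) = t * (t - 1) * (n + 2).choose t := by
    rw [htm2, ht2, show t2 + 2 - 1 = t2 + 1 from by omega]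
    have h1 := Nat.add_one_mul_choose_eq n t2            -- (n+1) C(n,t2) = C(n+1,t2+1)(t2+1)
    have h2 := Nat.add_one_mul_choose_eq (n + 1) (t2 + 1) -- (n+2) C(n+1,t2+1) = C(n+2,t2+2)(t2+2)
    calc (n + 2) * (n + 1) * n.choose t2 = (n + 2) * ((n + 1) * n.choose t2) := by ring
      _ = (n + 2) * ((n + 1).choose (t2 + 1) * (t2 + 1)) := by rw [h1]
      _ = ((n + 1 + 1) * (n + 1).choose (t2 + 1)) * (t2 + 1) := by ring
      _ = ((n + 1 + 1).choose (t2 + 1 + 1) * (t2 + 1 + 1)) * (t2 + 1) := by rw [h2]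
      _ = (t2 + 2) * (t2 + 1) * (n + 2).choose (t2 + 2) := by ring
  -- i2: n C(n-1,t-2) = (n-t+2) C(n,t-2)   [C(n,t-2) (n - (t-2)) ... ] use choose_succ_right_eq: C(n,k+1)(k+1) = C(n,k)(n-k) and add_one_mul_choose
  have i2 : n * (n - 1).choose (t - 2) = (n - (t - 2)) * n.choose (t - 2) := by
    obtain ⟨n', hn'⟩ : ∃ n', n = n' + 1 := ⟨n - 1, by omega⟩
    rw [hn', Nat.add_sub_cancel, htm2]
    rcases Nat.eq_zero_or_pos t2 with h0 | hpos
    · rw [h0]; simp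
    · obtain ⟨k, hk⟩ : ∃ k, t2 = k + 1 := ⟨t2 - 1, by omega⟩
      rw [hk]
      have h1 := Nat.add_one_mul_choose_eq n' k      -- (n'+1) C(n',k) = C(n'+1,k+1)(k+1)
      have h2 := Nat.choose_succ_right_eq (n' + 1) k  -- C(n'+1,k+1)(k+1) = C(n'+1,k)(n'+1-k)
      -- want (n'+1) C(n', k+1) = (n'+1-(k+1)) C(n'+1,k+1)
      have h3 := Nat.add_one_mul_choose_eq n' (k + 1)   -- (n'+1) C(n',k+1) = C(n'+1,k+2)(k+2)
      have h4 := Nat.choose_succ_right_eq (n' + 1) (k + 1) -- C(n'+1,k+2)(k+2) = C(n'+1,k+1)(n'+1-(k+1))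
      rw [h3, h4, mul_comm]
  -- i3: (n+1) n C(n-1,t-2) = t (t-1) C(n+1,t)
  have i3 : (n + 1) * n * (n - 1).choose (t - 2) = t * (t - 1) * (n + 1).choose t := by
    obtain ⟨n', hn'⟩ : ∃ n', n = n' + 1 := ⟨n - 1, by omega⟩
    rw [hn', Nat.add_sub_cancel, htm2, ht2, show t2 + 2 - 1 = t2 + 1 from by omega]
    have h1 := Nat.add_one_mul_choose_eq n' t2
    have h2 := Nat.add_one_mul_choose_eq (n' + 1) (t2 + 1)
    calc (n' + 1 + 1) * (n' + 1) * n'.choose t2 = (n' + 1 + 1) * ((n' + 1) * n'.choose t2) := by ring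
      _ = (n' + 1 + 1) * ((n' + 1).choose (t2 + 1) * (t2 + 1)) := by rw [h1]
      _ = ((n' + 1 + 1) * (n' + 1).choose (t2 + 1)) * (t2 + 1) := by ring
      _ = ((n' + 1 + 1).choose (t2 + 1 + 1) * (t2 + 1 + 1)) * (t2 + 1) := by rw [h2]
      _ = (t2 + 2) * (t2 + 1) * (n' + 1 + 1).choose (t2 + 2) := by ring
  -- i4: (n-1) C(n-2,t-2) = (n-1-(t-2)) C(n-1,t-2)
  have i4 : (n - 1) * (n - 2).choose (t - 2) = (n - 1 - (t - 2)) * (n - 1).choose (t - 2) := by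
    obtain ⟨n', hn'⟩ : ∃ n', n = n' + 2 := ⟨n - 2, by omega⟩
    rw [hn', show n' + 2 - 1 = n' + 1 from by omega, Nat.add_sub_cancel, htm2]
    rcases Nat.eq_zero_or_pos t2 with h0 | hpos
    · rw [h0]; simp
    · obtain ⟨k, hk⟩ : ∃ k, t2 = k + 1 := ⟨t2 - 1, by omega⟩
      rw [hk]
      have h3 := Nat.add_one_mul_choose_eq n' (k + 1)
      have h4 := Nat.choose_succ_right_eq (n' + 1) (k + 1)
      rw [h3, h4, mul_comm]
  -- i5: (n+1) C(n,t-2) = (t-1) C(n+1,t-1)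
  have i5 : (n + 1) * n.choose (t - 2) = (t - 1) * (n + 1).choose (t - 1) := by
    rw [htm2, htm1, Nat.add_one_mul_choose_eq, mul_comm]
  -- casts
  have i1Z : ((n : ℤ) + 2) * (n + 1) * (n.choose (t - 2) : ℤ) = (t : ℤ) * (t - 1) * ((n + 2).choose t : ℤ) := by
    have := congrArg (fun k : ℕ => (k : ℤ)) i1; push_cast [Nat.cast_sub (show 1 ≤ t by omega)] at this; linarith
  have i2Z : (n : ℤ) * ((n - 1).choose (t - 2) : ℤ) = ((n : ℤ) - t + 2) * (n.choose (t - 2) : ℤ) := by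
    have := congrArg (fun k : ℕ => (k : ℤ)) i2; push_cast [Nat.cast_sub (show t - 2 ≤ n by omega), Nat.cast_sub (show 2 ≤ t by omega)] at this
    linarith
  have i3Z : ((n : ℤ) + 1) * n * ((n - 1).choose (t - 2) : ℤ) = (t : ℤ) * (t - 1) * ((n + 1).choose t : ℤ) := by
    have := congrArg (fun k : ℕ => (k : ℤ)) i3; push_cast [Nat.cast_sub (show 1 ≤ t by omega)] at this; linarith
  have i4Z : ((n : ℤ) - 1) * ((n - 2).choose (t - 2) : ℤ) = ((n : ℤ) - t + 1) * ((n - 1).choose (t - 2) : ℤ) := by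
    have := congrArg (fun k : ℕ => (k : ℤ)) i4
    push_cast [Nat.cast_sub (show 1 ≤ n by omega), Nat.cast_sub (show t - 2 ≤ n - 1 by omega), Nat.cast_sub (show 2 ≤ t by omega)] at this
    linarith
  have i5Z : ((n : ℤ) + 1) * (n.choose (t - 2) : ℤ) = ((t : ℤ) - 1) * ((n + 1).choose (t - 1) : ℤ) := by
    have := congrArg (fun k : ℕ => (k : ℤ)) i5; push_cast [Nat.cast_sub (show 1 ≤ t by omega)] at this; linarith
  have hC0 : (0 : ℤ) < ((n + 2).choose t : ℤ) := by exact_mod_cast Nat.choose_pos (by omega)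
  have hC1 : (0 : ℤ) < ((n + 1).choose t : ℤ) := by exact_mod_cast Nat.choose_pos (by omega)
  have hC2 : (0 : ℤ) < ((n + 1).choose (t - 1) : ℤ) := by exact_mod_cast Nat.choose_pos (by omega)
  have hC3 : (0 : ℤ) < (n.choose (t - 2) : ℤ) := by exact_mod_cast Nat.choose_pos (by omega)
  have hC4 : (0 : ℤ) < ((n - 1).choose (t - 2) : ℤ) := by exact_mod_cast Nat.choose_pos (by omega)
  refine ⟨?_, ?_⟩
  · -- plain t-density
    have hP : ∀ Y ∈ (lev m 1).powersetCard (t - 2),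
        (cH t (n + 2) : ℤ) * ((#(A1.filter fun w => w ⊆ lev m 1 \ Y) : ℤ) + #(Qd.filter fun w => w ⊆ lev m 1 \ Y)
          + #(Qd'.filter fun w => w ⊆ lev m 1 \ Y) + #(ET.filter fun w => w ⊆ lev m 1 \ Y))
          ≤ ((n + 2).choose t : ℤ) * kap 𝒳 𝒵 ∅ (dbl m ∪ (lev m 1 \ Y)) := fun Y hY => by
      have h := densityT_le_kap h𝒳 h𝒵 t (n + 2) ∅ (dbl m ∪ (lev m 1 \ Y)) (disjoint_empty_left _) (hnY Y hY) (hltX _) (hltZ _)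
      have hk := card_kinds_le_csetsT (𝒳 := 𝒳) (𝒵 := 𝒵) (s := lev m 1 \ Y) ht hDe hdd' hdT hd'T
      have h2 := mul_le_mul_of_nonneg_left (show ((#(A1.filter fun w => w ⊆ lev m 1 \ Y) : ℤ) + #(Qd.filter fun w => w ⊆ lev m 1 \ Y)
          + #(Qd'.filter fun w => w ⊆ lev m 1 \ Y) + #(ET.filter fun w => w ⊆ lev m 1 \ Y))
          ≤ #(csetsT 𝒳 𝒵 ∅ (dbl m ∪ (lev m 1 \ Y)) t) by exact_mod_cast hk) (show (0 : ℤ) ≤ cH t (n + 2) from Nat.cast_nonneg _)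
      linarith
    have sP := sum_le_sum hP
    rw [← mul_sum, ← mul_sum, sum_add_distrib, sum_add_distrib, sum_add_distrib, dA, dQ, dQ', dE] at sP
    generalize hR : ∑ Y ∈ (lev m 1).powersetCard (t - 2), kap 𝒳 𝒵 ∅ (dbl m ∪ (lev m 1 \ Y)) = R at sP ⊢
    generalize ha : (#A1 : ℤ) = a at sP ⊢
    generalize hq : (#Qd : ℤ) = q1 at sP ⊢
    generalize hq' : (#Qd' : ℤ) = q2 at sP ⊢
    generalize hε : (#ET : ℤ) = ε at sP ⊢
    generalize hA : (cH t (n + 2) : ℤ) = A at sP ⊢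
    generalize hB0 : ((n + 2).choose t : ℤ) = B0 at sP i1Z hC0 ⊢
    generalize hB3 : (n.choose (t - 2) : ℤ) = B3 at sP i1Z i2Z hC3 ⊢
    generalize hB4 : ((n - 1).choose (t - 2) : ℤ) = B4 at sP i2Z i4Z hC4 ⊢
    generalize hB5 : ((n - 2).choose (t - 2) : ℤ) = B5 at sP i4Z ⊢
    refine le_of_mul_le_mul_left ?_ hC0
    -- B0 * (A t(t-1) (n(n-1) a + (n-1)(n-t+2)(q1+q2) + (n-t+2)(n-t+1) ε)) = (n+2)(n+1)n(n-1) * (A (a B3 + q1 B4 + q2 B4 + ε B5))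
    have e3 : ((n : ℤ) + 2) * (n + 1) * n * (n - 1) * B3 = B0 * ((t : ℤ) * (t - 1) * (n * (n - 1))) := by
      linear_combination (n * (n - 1)) * i1Z
    have e4 : ((n : ℤ) + 2) * (n + 1) * n * (n - 1) * B4 = B0 * ((t : ℤ) * (t - 1) * ((n - 1) * (n - t + 2))) := by
      have : ((n : ℤ) + 2) * (n + 1) * n * (n - 1) * B4 = ((n : ℤ) + 2) * (n + 1) * (n - 1) * (n * B4) := by ring
      rw [this, i2Z]; linear_combination ((n - 1) * (n - t + 2)) * i1Z
    have e5 : ((n : ℤ) + 2) * (n + 1) * n * (n - 1) * B5 = B0 * ((t : ℤ) * (t - 1) * ((n - t + 2) * (n - t + 1))) := by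
      have : ((n : ℤ) + 2) * (n + 1) * n * (n - 1) * B5 = ((n : ℤ) + 2) * (n + 1) * n * ((n - 1) * B5) := by ring
      rw [this, i4Z]
      have : ((n : ℤ) + 2) * (n + 1) * n * ((n - t + 1) * B4) = ((n : ℤ) + 2) * (n + 1) * (n - t + 1) * (n * B4) := by ring
      rw [this, i2Z]; linear_combination ((n - t + 2) * (n - t + 1)) * i1Z
    have key : B0 * (A * ((t : ℤ) * (t - 1) * (n * (n - 1) * a + (n - 1) * (n - t + 2) * (q1 + q2) + (n - t + 2) * (n - t + 1) * ε)))
        = ((n : ℤ) + 2) * (n + 1) * n * (n - 1) * (A * (a * B3 + q1 * B4 + q2 * B4 + ε * B5)) := by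
      linear_combination (-(A * a)) * e3 - (A * (q1 + q2)) * e4 - (A * ε) * e5
    rw [key]
    have hpos : (0 : ℤ) ≤ ((n : ℤ) + 2) * (n + 1) * n * (n - 1) := by
      have : (0 : ℤ) ≤ (n : ℤ) - 1 := by linarith
      positivity
    have fin := mul_le_mul_of_nonneg_left sP hpos
    linarith only [fin]
  · -- pinned t-density at d
    have hP : ∀ Y ∈ (lev m 1).powersetCard (t - 2),
        ((cH t (n + 1) * (n + 1).choose t : ℕ) : ℤ) * ((#(A1.filter fun w => w ⊆ lev m 1 \ Y) : ℤ) + #(Qd.filter fun w => w ⊆ lev m 1 \ Y))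
          + ((cH (t - 1) (n + 1) * (n + 1).choose (t - 1) : ℕ) : ℤ) * ((#(Qd'.filter fun w => w ⊆ lev m 1 \ Y) : ℤ)
            + #(ET.filter fun w => w ⊆ lev m 1 \ Y))
          ≤ (((n + 1).choose (t - 1) * (n + 1).choose t : ℕ) : ℤ) * kap 𝒳 𝒵 ∅ (dbl m ∪ (lev m 1 \ Y)) := fun Y hY => by
      have h := pinnedT_le_kap h𝒳 h𝒵 (t - 1) (n + 1) ∅ (dbl m ∪ (lev m 1 \ Y)) d (disjoint_empty_left _) (hnY Y hY)
        (mem_union_left _ hd) (by omega) (by rw [show t - 1 + 1 = t from by omega]; exact hltX _)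
        (by rw [show t - 1 + 1 = t from by omega]; exact hltZ _)
      rw [show t - 1 + 1 = t from by omega] at h
      have h1 := card_pinned_kinds_le (𝒳 := 𝒳) (𝒵 := 𝒵) (s := lev m 1 \ Y) ht hDe hdd' hdT hd'T
      have h2 := card_unpinned_kinds_le (𝒳 := 𝒳) (𝒵 := 𝒵) (s := lev m 1 \ Y) ht hDe hdd' hdT hd'T
      have m1 := mul_le_mul_of_nonneg_left (show ((#(A1.filter fun w => w ⊆ lev m 1 \ Y) : ℤ) + #(Qd.filter fun w => w ⊆ lev m 1 \ Y))
          ≤ #((csetsT 𝒳 𝒵 ∅ (dbl m ∪ (lev m 1 \ Y)) t).filter fun w => d ∈ w) by exact_mod_cast h1)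
        (show (0 : ℤ) ≤ ((cH t (n + 1) * (n + 1).choose t : ℕ) : ℤ) from Nat.cast_nonneg _)
      have m2 := mul_le_mul_of_nonneg_left (show ((#(Qd'.filter fun w => w ⊆ lev m 1 \ Y) : ℤ) + #(ET.filter fun w => w ⊆ lev m 1 \ Y))
          ≤ #((csetsT 𝒳 𝒵 ∅ (dbl m ∪ (lev m 1 \ Y)) t).filter fun w => d ∉ w) by exact_mod_cast h2)
        (show (0 : ℤ) ≤ ((cH (t - 1) (n + 1) * (n + 1).choose (t - 1) : ℕ) : ℤ) from Nat.cast_nonneg _)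
      linarith
    have sP := sum_le_sum hP
    rw [sum_add_distrib, ← mul_sum, ← mul_sum, ← mul_sum, sum_add_distrib, sum_add_distrib, dA, dQ, dQ', dE] at sP
    push_cast at sP
    generalize hR : ∑ Y ∈ (lev m 1).powersetCard (t - 2), kap 𝒳 𝒵 ∅ (dbl m ∪ (lev m 1 \ Y)) = R at sP ⊢
    generalize ha : (#A1 : ℤ) = a at sP ⊢
    generalize hq : (#Qd : ℤ) = q1 at sP ⊢
    generalize hq' : (#Qd' : ℤ) = q2 at sP ⊢
    generalize hε : (#ET : ℤ) = ε at sP ⊢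
    generalize hPP : (cH t (n + 1) : ℤ) = P at sP ⊢
    generalize hQQ : (cH (t - 1) (n + 1) : ℤ) = Q' at sP ⊢
    generalize hB1 : ((n + 1).choose t : ℤ) = B1 at sP i3Z hC1 ⊢
    generalize hB2 : ((n + 1).choose (t - 1) : ℤ) = B2 at sP i5Z hC2 ⊢
    generalize hB3 : (n.choose (t - 2) : ℤ) = B3 at sP i2Z i5Z hC3 ⊢
    generalize hB4 : ((n - 1).choose (t - 2) : ℤ) = B4 at sP i2Z i3Z i4Z hC4 ⊢
    generalize hB5 : ((n - 2).choose (t - 2) : ℤ) = B5 at sP i4Z ⊢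
    have hpos : 0 < B2 * B1 := mul_pos hC2 hC1
    refine le_of_mul_le_mul_left ?_ hpos
    -- identities: (n+1)n(n-1)·B3 = B2·((t-1) n (n-1));  (n+1)n(n-1) B4 = B2 (t-1)(n-1)(n-t+2) [via i2,i5];
    --             (n+1)n(n-1) B4 = B1 t(t-1)(n-1) [i3];  (n+1)n(n-1) B5 = B1 t(t-1)(n-t+1) [i4,i3]
    have f3 : ((n : ℤ) + 1) * n * (n - 1) * B3 = B2 * (((t : ℤ) - 1) * n * (n - 1)) := by linear_combination (n * (n - 1)) * i5Z
    have f4 : ((n : ℤ) + 1) * n * (n - 1) * B4 = B2 * (((t : ℤ) - 1) * (n - 1) * (n - t + 2)) := by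
      have : ((n : ℤ) + 1) * n * (n - 1) * B4 = ((n : ℤ) + 1) * (n - 1) * (n * B4) := by ring
      rw [this, i2Z]; linear_combination ((n - 1) * (n - t + 2)) * i5Z
    have f4' : ((n : ℤ) + 1) * n * (n - 1) * B4 = B1 * ((t : ℤ) * (t - 1) * (n - 1)) := by linear_combination (n - 1) * i3Z
    have f5 : ((n : ℤ) + 1) * n * (n - 1) * B5 = B1 * ((t : ℤ) * (t - 1) * (n - t + 1)) := by
      have : ((n : ℤ) + 1) * n * (n - 1) * B5 = ((n : ℤ) + 1) * n * ((n - 1) * B5) := by ring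
      rw [this, i4Z]; linear_combination (n - t + 1) * i3Z
    have key : B2 * B1 * (P * (((t : ℤ) - 1) * n * (n - 1) * a + (t - 1) * (n - 1) * (n - t + 2) * q1)
        + Q' * ((t : ℤ) * (t - 1) * (n - 1) * q2 + t * (t - 1) * (n - t + 1) * ε))
        = ((n : ℤ) + 1) * n * (n - 1) * (P * B1 * (a * B3 + q1 * B4) + Q' * B2 * (q2 * B4 + ε * B5)) := by
      linear_combination (-(P * B1 * a)) * f3 - (P * B1 * q1) * f4 - (Q' * B2 * q2) * f4' - (Q' * B2 * ε) * f5
    rw [key]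
    have hpos' : (0 : ℤ) ≤ ((n : ℤ) + 1) * n * (n - 1) := by
      have : (0 : ℤ) ≤ (n : ℤ) - 1 := by linarith
      positivity
    have fin := mul_le_mul_of_nonneg_left sP hpos'
    linarith only [fin]

end RowTwoTSupply

end Summit.CriticalPhenomena.PercolationContinuityZ3.Theorems.SahiCTCForms
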